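import Summits.AtomisticToContinuum.HydrodynamicLimit.Theorems.InformationPercolationEngineKickFairRelEquilibriumMesoTransferCoreA

/-!
# `KickFairRelEquilibriumMeso`, line `Sketch` — glue T, part (d2): the kept level set, one window

Helper file (`--supports stmt-AtomisticToContinuum-15177`) of the line lead for the registered glue stub
`stub_pinchTransfer` (registered sub-goal here: `transferKept`). On a level set `Bz` of the time-zero key carrying
`LG`-mass `≥ e^{-η(N+1)}`, given the bias and concentration conclusions of R″ for one kinetic window, the three
conditional transfers (part d1), the global domination `LG ≤ Λ^{N+1} G_{θ₁}` and the count tail E1 under `G_{θ₁}`: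
`∫_{Bz} |Z| dLG ≤ ((δ′ + 1/L) t_N + KX) LG(Bz)` with `KX = Λs³ (2C_g λ + δ′ + 2C_g)(e^{-c(N+1)} + e^{-3(N+1)})`
(`kept_window_bound`): `|Z| ≤ (δ′ + 1/L)t_N + (|Z − m_B| − t_N/L)₊`, the excess is transferred `LG → G_{θ₁}` through
`G₁` (two dominations, cancelling `G₁(Bz)`), lives on the deviation event (measure `≤ Λs e^{-c(N+1)} G_{θ₁}(Bz)` by
R″(ii) transferred `G₁ → G_{θ₁}`) where it is `≤ 2C_g countFn + |m_B|`, and the count is split at `λ` (E1); the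
lower bound `G_{θ₁}(Bz) ≥ Λ^{-(N+1)} e^{-η(N+1)}` absorbs the tail.
-/

noncomputable section

open MeasureTheory Set Filter Topology
open scoped ENNReal Classical

namespace Summit.AtomisticToContinuum.HydrodynamicLimit.Theorems.KickFairRelEquilibriumMesoLine

open Literature.Analysis.FluidPDE Literature.MathematicalPhysics.KineticTheory
open Summit.AtomisticToContinuum.HydrodynamicLimit.Theorems

variable {σ : ℝ} {N : ℕ}
/-! ## The estimate on one level set: kept case (one window) and non-kept case (all windows) -/

section LevelSet

variable {Φ : Flow σ N} {a₀ θ₀ : T3 → ℝ} {u₀ : T3 → V3} {θ₁ : ℝ} {z₀ : Phase N}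

local notation "μL" => localGibbsLaw σ a₀ u₀ θ₀ N Φ
local notation "νL" => localGibbsLaw σ (fun _ => (1 : ℝ)) (fun _ => (0 : V3)) (fun _ => (1 : ℝ)) N Φ
local notation "νT" => localGibbsLaw σ (fun _ => (1 : ℝ)) (fun _ => (0 : V3)) (fun _ => θ₁) N Φ
local notation "Bz" => keyLevel N z₀

/-- **Kept level set, one window.** Under the bias and concentration conclusions of R″ for the window `(t₁, t₂]` on the
level set `Bz` (of `LG`-mass `≥ e^{-η(N+1)}`), the three conditional transfers with constant `Λs`, the global domination
`LG ≤ Λ^{N+1} G_{θ₁}` and the count tail E1 under `G_{θ₁}`: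
`∫_{Bz} |Z| dLG ≤ ((δ′ + 1/L) t_N + KX) · LG(Bz)`, `KX = Λs³ (2C_g λ + δ′ + 2C_g)(e^{-c(N+1)} + e^{-3(N+1)})`. [folklore] -/
theorem kept_window_bound (hPM : PastMeasurable) (hσ : 0 < σ) (hσ2 : σ ≤ 1 / 2)
    (hθ₁ : 0 < θ₁) {Λ : ℝ} (hΛ : 1 ≤ Λ) (hdom : (μL) ≤ ENNReal.ofReal (Λ ^ (N + 1)) • (νT))
    {τ : ℝ} {g : V3 × V3 × V3 → ℝ} (hg : Continuous g) {Cg : ℝ} (hCg : ∀ p, |g p| ≤ Cg)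
    {h : Fin (N + 1) → ℕ → Past N → ℝ} (hh : ∀ i n, Measurable (h i n)) (hhb : ∀ i n p, |h i n p| ≤ 1)
    {lam M₁ : ℝ} (hlam : 0 ≤ lam)
    (hE1N : ∫⁻ z in {z | lam < countFn Φ τ z}, ENNReal.ofReal (countFn Φ τ z) ∂(νT) ≤
      ENNReal.ofReal (Real.exp (-(M₁ * ((N : ℝ) + 1)))))
    {Λs : ℝ} (hΛs1 : 1 ≤ Λs)
    (TB : ∀ F : Phase N → ℝ≥0∞, Measurable F →
      ((νL) Bz * ∫⁻ z in Bz, F z ∂(μL) ≤ ENNReal.ofReal Λs * (μL) Bz * ∫⁻ z in Bz, F z ∂(νL)) ∧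
      ((νT) Bz * ∫⁻ z in Bz, F z ∂(νL) ≤ ENNReal.ofReal Λs * (νL) Bz * ∫⁻ z in Bz, F z ∂(νT)) ∧
      ((νL) Bz * ∫⁻ z in Bz, F z ∂(νT) ≤ ENNReal.ofReal Λs * (νT) Bz * ∫⁻ z in Bz, F z ∂(νL)))
    {δ' L c η : ℝ} (hδ' : 0 < δ') (hL : 0 < L) (t₁ t₂ : ℝ)
    (hkept : ENNReal.ofReal (Real.exp (-(η * ((N : ℝ) + 1)))) ≤ (μL) Bz)
    (hbias : |∫ z in Bz, slotSum Φ τ (rs N) t₁ t₂ g h z ∂(νL)| ≤ δ' * tN N * ((νL) Bz).toReal)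
    (hconc : (νL) (Bz ∩ {z | tN N / L < |slotSum Φ τ (rs N) t₁ t₂ g h z -
        ((νL) Bz).toReal⁻¹ * ∫ z in Bz, slotSum Φ τ (rs N) t₁ t₂ g h z ∂(νL)|}) ≤
      ENNReal.ofReal (Real.exp (-(c * ((N : ℝ) + 1)))) * (νL) Bz)
    (hM₁ : Real.log Λ + η + 3 ≤ M₁) :
    ∫⁻ z in Bz, ENNReal.ofReal |slotSum Φ τ (rs N) t₁ t₂ g h z| ∂(μL) ≤
      (ENNReal.ofReal ((δ' + 1 / L) * tN N) + ENNReal.ofReal (Λs ^ 3 * (2 * Cg * lam + δ' + 2 * Cg) *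
        (Real.exp (-(c * ((N : ℝ) + 1))) + Real.exp (-(3 * ((N : ℝ) + 1)))))) * (μL) Bz := by
  set μ : Measure (Phase N) := μL with hμdef
  set ν : Measure (Phase N) := νL with hνdef
  set ν' : Measure (Phase N) := νT with hν'def
  set Z : Phase N → ℝ := slotSum Φ τ (rs N) t₁ t₂ g h with hZdef
  have hCg0 : 0 ≤ Cg := (abs_nonneg _).trans (hCg 0)
  haveI : IsProbabilityMeasure ν := isProbabilityMeasure_localGibbsLaw continuous_const continuous_const
    continuous_const (fun _ => one_pos) (fun _ => one_pos) hσ2 N Φ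
  haveI : IsProbabilityMeasure ν' := isProbabilityMeasure_localGibbsLaw continuous_const continuous_const
    continuous_const (fun _ => one_pos) (fun _ => hθ₁) hσ2 N Φ
  have hμν : μ ≪ ν := localGibbsLaw_absolutelyContinuous_localGibbsLaw continuous_const continuous_const
    continuous_const (fun _ => one_pos) (fun _ => one_pos) a₀ u₀ θ₀ hσ2 N Φ
  have hμν' : μ ≪ ν' := localGibbsLaw_absolutelyContinuous_localGibbsLaw continuous_const continuous_const
    continuous_const (fun _ => one_pos) (fun _ => hθ₁) a₀ u₀ θ₀ hσ2 N Φ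
  have hν'ν : ν' ≪ ν := localGibbsLaw_absolutelyContinuous_localGibbsLaw continuous_const continuous_const
    continuous_const (fun _ => one_pos) (fun _ => one_pos) _ _ _ hσ2 N Φ
  have hdomB : ∀ A : Set (Phase N), μ A ≤ ENNReal.ofReal (Λ ^ (N + 1)) * ν' A := fun A => by
    have := Measure.le_iff'.1 hdom A
    simpa [Measure.smul_apply, smul_eq_mul] using this
  have hgood : ∀ {ρ : Measure (Phase N)}, ρ Φ.goodᶜ = 0 → ∀ᵐ z ∂ρ, z ∈ Φ.good := fun h0 => mem_ae_iff.2 h0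
  have hμg : μ Φ.goodᶜ = 0 := localGibbsLaw_compl_good_eq_zero Φ
  have hνg : ν Φ.goodᶜ = 0 := localGibbsLaw_compl_good_eq_zero Φ
  have hν'g : ν' Φ.goodᶜ = 0 := localGibbsLaw_compl_good_eq_zero Φ
  have hκν : ∀ᵐ z ∂ν, ∀ i : Fin (N + 1), ∀ n : ℕ, |kappa Φ (rs N) g i n z| ≤ Cg :=
    ae_forall_abs_kappa_le Φ (rs N) hCg
  have hκν' : ∀ᵐ z ∂ν', ∀ i : Fin (N + 1), ∀ n : ℕ, |kappa Φ (rs N) g i n z| ≤ Cg := hν'ν.ae_le hκν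
  have hWm : Measurable (countFn Φ τ) := measurable_countFn hPM hσ Φ τ
  have hBzm : MeasurableSet Bz := measurableSet_keyLevel z₀
  have htN0 := (tN_pos N).le
  have htN1 := tN_le_one N
  -- masses
  have hμB0 : μ Bz ≠ 0 := fun h0 => by
    rw [h0, nonpos_iff_eq_zero, ENNReal.ofReal_eq_zero] at hkept
    exact absurd hkept (not_le.2 (Real.exp_pos _))
  have hνB0 : ν Bz ≠ 0 := fun h0 => hμB0 (hμν h0)
  have hν'B0 : ν' Bz ≠ 0 := fun h0 => hμB0 (hμν' h0)
  have hνtop : ν Bz ≠ ⊤ := measure_ne_top _ _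
  have hν'top : ν' Bz ≠ ⊤ := measure_ne_top _ _
  -- the conditional mean
  set mk : ℝ := (ν Bz).toReal⁻¹ * ∫ z in Bz, Z z ∂ν with hmk
  set t : ℝ := tN N / L with ht
  have ht0 : 0 ≤ t := div_nonneg htN0 hL.le
  have hνBpos : 0 < (ν Bz).toReal := ENNReal.toReal_pos hνB0 hνtop
  have hmk_le : |mk| ≤ δ' * tN N := by
    rw [hmk, abs_mul, abs_inv, abs_of_pos hνBpos]
    calc (ν Bz).toReal⁻¹ * |∫ z in Bz, Z z ∂ν| ≤ (ν Bz).toReal⁻¹ * (δ' * tN N * (ν Bz).toReal) :=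
          mul_le_mul_of_nonneg_left hbias (inv_nonneg.2 hνBpos.le)
      _ = δ' * tN N := by field_simp
  -- measurable modification
  set ZG : Phase N → ℝ := slotSumGood Φ τ (rs N) t₁ t₂ g h with hZG
  have hZGm : Measurable ZG := measurable_slotSumGood hPM hσ Φ τ (rs N) _ _ hg hh
  have hZZG : ∀ {ρ : Measure (Phase N)}, ρ Φ.goodᶜ = 0 → ∀ᵐ z ∂ρ, Z z = ZG z := fun hρ =>
    (hgood hρ).mono fun z hz => slotSum_eq_slotSumGood_of_mem_good Φ τ (rs N) _ _ g h hz
  set ppG : Phase N → ℝ := fun z => max (|ZG z - mk| - t) 0 with hppG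
  have hppGm : Measurable fun z => ENNReal.ofReal (ppG z) :=
    ((((hZGm.sub measurable_const).abs).sub measurable_const).max measurable_const).ennreal_ofReal
  set E' : Set (Phase N) := {z | t < |ZG z - mk|} with hE'
  have hE'm : MeasurableSet E' := measurableSet_lt measurable_const ((hZGm.sub measurable_const).abs)
  -- pointwise: |Z| ≤ (δ' + 1/L) tN + pp
  have hpt : ∀ᵐ z ∂μ, ENNReal.ofReal |Z z| ≤ ENNReal.ofReal ((δ' + 1 / L) * tN N) + ENNReal.ofReal (ppG z) := by
    filter_upwards [hZZG hμg] with z hz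
    rw [← ENNReal.ofReal_add (mul_nonneg (by positivity) htN0) (le_max_right _ _)]
    refine ENNReal.ofReal_le_ofReal ?_
    rw [hz]
    have h1 : |ZG z| ≤ |ZG z - mk| + |mk| := by
      calc |ZG z| = |(ZG z - mk) + mk| := by ring_nf
        _ ≤ |ZG z - mk| + |mk| := abs_add_le _ _
    have hmax : |ZG z - mk| ≤ t + max (|ZG z - mk| - t) 0 := by
      rcases le_or_gt (|ZG z - mk| - t) 0 with h0 | h0
      · rw [max_eq_right h0]; linarith
      · rw [max_eq_left h0.le]; linarith
    have heq : (δ' + 1 / L) * tN N = δ' * tN N + t := by rw [ht]; ring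
    rw [heq]; linarith
  have hstep1 : ∫⁻ z in Bz, ENNReal.ofReal |Z z| ∂μ ≤
      ENNReal.ofReal ((δ' + 1 / L) * tN N) * μ Bz + ∫⁻ z in Bz, ENNReal.ofReal (ppG z) ∂μ := by
    calc ∫⁻ z in Bz, ENNReal.ofReal |Z z| ∂μ
        ≤ ∫⁻ z in Bz, ENNReal.ofReal ((δ' + 1 / L) * tN N) + ENNReal.ofReal (ppG z) ∂μ :=
          lintegral_mono_ae (ae_restrict_of_ae hpt)
      _ = ENNReal.ofReal ((δ' + 1 / L) * tN N) * μ Bz + ∫⁻ z in Bz, ENNReal.ofReal (ppG z) ∂μ := by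
          rw [lintegral_add_left measurable_const, setLIntegral_const, mul_comm]
  -- transfer of the excess μ → ν' through ν
  obtain ⟨TB1, TB2, -⟩ := TB _ hppGm
  have hX : ν' Bz * ∫⁻ z in Bz, ENNReal.ofReal (ppG z) ∂μ ≤
      ENNReal.ofReal Λs * ENNReal.ofReal Λs * μ Bz * ∫⁻ z in Bz, ENNReal.ofReal (ppG z) ∂ν' :=
    chain_cancel hνB0 hνtop TB1 TB2
  -- the excess under ν'
  have hWsplit : ∀ A : Set (Phase N), ∫⁻ z in A, ENNReal.ofReal (2 * Cg * countFn Φ τ z) ∂ν' ≤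
      ENNReal.ofReal (2 * Cg * lam) * ν' A + ENNReal.ofReal (2 * Cg) *
        ENNReal.ofReal (Real.exp (-(M₁ * ((N : ℝ) + 1)))) := fun A =>
    (setLIntegral_W_le (ν := ν') Φ τ lam hCg0 hWm A).trans (by gcongr)
  have hXν' : ∫⁻ z in Bz, ENNReal.ofReal (ppG z) ∂ν' ≤
      (ENNReal.ofReal (2 * Cg * lam) + ENNReal.ofReal (δ' * tN N)) * ν' (Bz ∩ E') +
        ENNReal.ofReal (2 * Cg) * ENNReal.ofReal (Real.exp (-(M₁ * ((N : ℝ) + 1)))) := by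
    have hZWν' : ∀ᵐ z ∂ν', |Z z| ≤ 2 * Cg * countFn Φ τ z := by
      filter_upwards [hgood hν'g, hκν'] with z hz hκz
      exact abs_slotSum_le_of_kappa_le Φ hσ τ (rs N) _ _ hCg hhb hz hκz
    have hpp_le : ∀ᵐ z ∂ν', ENNReal.ofReal (ppG z) ≤
        E'.indicator (fun z => ENNReal.ofReal (2 * Cg * countFn Φ τ z) + ENNReal.ofReal (δ' * tN N)) z := by
      filter_upwards [hZZG hν'g, hZWν'] with z hz hzW
      by_cases hzE : z ∈ E'
      · rw [indicator_of_mem hzE, ← ENNReal.ofReal_add (mul_nonneg (by positivity) (countFn_nonneg Φ hσ τ z))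
          (mul_nonneg hδ'.le htN0)]
        refine ENNReal.ofReal_le_ofReal ?_
        have h1 : max (|ZG z - mk| - t) 0 ≤ |ZG z - mk| := max_le (by linarith) (abs_nonneg _)
        have h2 : |ZG z - mk| ≤ |ZG z| + |mk| := abs_sub _ _
        have h3 : |ZG z| ≤ 2 * Cg * countFn Φ τ z := by rw [← hz]; exact hzW
        show max (|ZG z - mk| - t) 0 ≤ _
        linarith
      · rw [indicator_of_notMem hzE]
        have : ppG z = 0 := by
          simp only [hE', mem_setOf_eq, not_lt] at hzE
          exact max_eq_right (by linarith)
        rw [this, ENNReal.ofReal_zero]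
    calc ∫⁻ z in Bz, ENNReal.ofReal (ppG z) ∂ν'
        ≤ ∫⁻ z in Bz, E'.indicator (fun z => ENNReal.ofReal (2 * Cg * countFn Φ τ z) +
            ENNReal.ofReal (δ' * tN N)) z ∂ν' := lintegral_mono_ae (ae_restrict_of_ae hpp_le)
      _ = ∫⁻ z in Bz ∩ E', ENNReal.ofReal (2 * Cg * countFn Φ τ z) + ENNReal.ofReal (δ' * tN N) ∂ν' := by
          rw [lintegral_indicator hE'm, Measure.restrict_restrict hE'm, inter_comm]
      _ = ∫⁻ z in Bz ∩ E', ENNReal.ofReal (2 * Cg * countFn Φ τ z) ∂ν' +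
            ENNReal.ofReal (δ' * tN N) * ν' (Bz ∩ E') := by
          rw [lintegral_add_right _ measurable_const, setLIntegral_const]
      _ ≤ (ENNReal.ofReal (2 * Cg * lam) * ν' (Bz ∩ E') + ENNReal.ofReal (2 * Cg) *
            ENNReal.ofReal (Real.exp (-(M₁ * ((N : ℝ) + 1))))) + ENNReal.ofReal (δ' * tN N) * ν' (Bz ∩ E') :=
          add_le_add_left (hWsplit _) _
      _ = (ENNReal.ofReal (2 * Cg * lam) + ENNReal.ofReal (δ' * tN N)) * ν' (Bz ∩ E') +
            ENNReal.ofReal (2 * Cg) * ENNReal.ofReal (Real.exp (-(M₁ * ((N : ℝ) + 1)))) := by ring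
  -- the concentration event under ν, then under ν'
  have hE'ν : ν (Bz ∩ E') ≤ ENNReal.ofReal (Real.exp (-(c * ((N : ℝ) + 1)))) * ν Bz := by
    have hsets : (Bz ∩ E' : Set (Phase N)) =ᵐ[ν]
        (Bz ∩ {z | tN N / L < |Z z - mk|} : Set (Phase N)) := by
      refine (ae_eq_refl _).inter ?_
      filter_upwards [hZZG hνg] with z hz
      show (t < |ZG z - mk|) = (tN N / L < |Z z - mk|)
      rw [hz, ht]
    rw [measure_congr hsets]
    exact hconc
  have hE'ν' : ν' (Bz ∩ E') ≤ ENNReal.ofReal Λs * ENNReal.ofReal (Real.exp (-(c * ((N : ℝ) + 1)))) * ν' Bz := by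
    obtain ⟨-, -, TB3⟩ := TB _ (measurable_one.indicator hE'm)
    have hind : ∀ ρ : Measure (Phase N), ∫⁻ z in Bz, E'.indicator 1 z ∂ρ = ρ (Bz ∩ E') := fun ρ => by
      rw [lintegral_indicator_one hE'm, Measure.restrict_apply hE'm, inter_comm]
    rw [hind, hind] at TB3
    refine cancel_mass hνB0 hνtop (TB3.trans ?_)
    calc ENNReal.ofReal Λs * ν' Bz * ν (Bz ∩ E')
        ≤ ENNReal.ofReal Λs * ν' Bz * (ENNReal.ofReal (Real.exp (-(c * ((N : ℝ) + 1)))) * ν Bz) :=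
          mul_le_mul_right hE'ν _
      _ = ENNReal.ofReal Λs * ENNReal.ofReal (Real.exp (-(c * ((N : ℝ) + 1)))) * ν' Bz * ν Bz := by ring
  -- lower bound on ν'(Bz)
  have hexpM₁ : Λ ^ (N + 1) * Real.exp (-(M₁ * ((N : ℝ) + 1))) ≤ Real.exp (-((η + 3) * ((N : ℝ) + 1))) :=
    pow_mul_exp_neg_le hΛ (by linarith) N
  have hLB : ENNReal.ofReal (Real.exp (-(M₁ * ((N : ℝ) + 1)))) ≤
      ENNReal.ofReal (Real.exp (-(3 * ((N : ℝ) + 1)))) * ν' Bz := by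
    have hΛp : 0 < Λ ^ (N + 1) := by positivity
    have h1 : ENNReal.ofReal (Real.exp (-(η * ((N : ℝ) + 1)))) ≤ ENNReal.ofReal (Λ ^ (N + 1)) * ν' Bz :=
      hkept.trans (hdomB _)
    -- multiply h1 by Λ^{-(N+1)} e^{-3(N+1)} and compare
    have h2 : ENNReal.ofReal (Real.exp (-(M₁ * ((N : ℝ) + 1)))) ≤
        ENNReal.ofReal ((Λ ^ (N + 1))⁻¹ * Real.exp (-(3 * ((N : ℝ) + 1)))) *
          ENNReal.ofReal (Real.exp (-(η * ((N : ℝ) + 1)))) := by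
      rw [← ENNReal.ofReal_mul (by positivity)]
      refine ENNReal.ofReal_le_ofReal ?_
      rw [mul_assoc, ← Real.exp_add, show -(3 * ((N : ℝ) + 1)) + -(η * ((N : ℝ) + 1)) =
        -((η + 3) * ((N : ℝ) + 1)) by ring, le_inv_mul_iff₀ hΛp]
      exact hexpM₁
    refine h2.trans ?_
    calc ENNReal.ofReal ((Λ ^ (N + 1))⁻¹ * Real.exp (-(3 * ((N : ℝ) + 1)))) *
          ENNReal.ofReal (Real.exp (-(η * ((N : ℝ) + 1))))
        ≤ ENNReal.ofReal ((Λ ^ (N + 1))⁻¹ * Real.exp (-(3 * ((N : ℝ) + 1)))) *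
            (ENNReal.ofReal (Λ ^ (N + 1)) * ν' Bz) := mul_le_mul_right h1 _
      _ = ENNReal.ofReal (Real.exp (-(3 * ((N : ℝ) + 1)))) * ν' Bz := by
          rw [← mul_assoc, ← ENNReal.ofReal_mul (by positivity), mul_comm ((Λ ^ (N + 1))⁻¹), mul_assoc,
            inv_mul_cancel₀ hΛp.ne', mul_one]
  -- assemble: X_ν' ≤ Q ν'(Bz)
  have hQ : ∫⁻ z in Bz, ENNReal.ofReal (ppG z) ∂ν' ≤
      ENNReal.ofReal ((2 * Cg * lam + δ' * tN N) * (Λs * Real.exp (-(c * ((N : ℝ) + 1)))) +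
        2 * Cg * Real.exp (-(3 * ((N : ℝ) + 1)))) * ν' Bz := by
    calc ∫⁻ z in Bz, ENNReal.ofReal (ppG z) ∂ν'
        ≤ (ENNReal.ofReal (2 * Cg * lam) + ENNReal.ofReal (δ' * tN N)) *
            (ENNReal.ofReal Λs * ENNReal.ofReal (Real.exp (-(c * ((N : ℝ) + 1)))) * ν' Bz) +
          ENNReal.ofReal (2 * Cg) * (ENNReal.ofReal (Real.exp (-(3 * ((N : ℝ) + 1)))) * ν' Bz) :=
          hXν'.trans (add_le_add (mul_le_mul_right hE'ν' _) (mul_le_mul_right hLB _))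
      _ = ENNReal.ofReal ((2 * Cg * lam + δ' * tN N) * (Λs * Real.exp (-(c * ((N : ℝ) + 1)))) +
            2 * Cg * Real.exp (-(3 * ((N : ℝ) + 1)))) * ν' Bz := by
          have hx : 0 ≤ 2 * Cg * lam + δ' * tN N := add_nonneg (mul_nonneg (by positivity) hlam) (mul_nonneg hδ'.le htN0)
          have hΛs0 : (0 : ℝ) ≤ Λs := by linarith
          rw [ENNReal.ofReal_add (mul_nonneg hx (mul_nonneg hΛs0 (Real.exp_pos _).le)) (by positivity),
            ENNReal.ofReal_mul hx, ENNReal.ofReal_mul hΛs0,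
            ENNReal.ofReal_add (mul_nonneg (by positivity) hlam) (mul_nonneg hδ'.le htN0),
            ENNReal.ofReal_mul (by positivity : (0 : ℝ) ≤ 2 * Cg), ENNReal.ofReal_mul (by positivity : (0 : ℝ) ≤ 2 * Cg)]
          ring
  -- X_μ ≤ KX μ Bz
  have hXμ : ∫⁻ z in Bz, ENNReal.ofReal (ppG z) ∂μ ≤ ENNReal.ofReal (Λs ^ 3 * (2 * Cg * lam + δ' + 2 * Cg) *
      (Real.exp (-(c * ((N : ℝ) + 1))) + Real.exp (-(3 * ((N : ℝ) + 1))))) * μ Bz := by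
    have h1 : ν' Bz * ∫⁻ z in Bz, ENNReal.ofReal (ppG z) ∂μ ≤
        (ENNReal.ofReal Λs * ENNReal.ofReal Λs * ENNReal.ofReal ((2 * Cg * lam + δ' * tN N) *
          (Λs * Real.exp (-(c * ((N : ℝ) + 1)))) + 2 * Cg * Real.exp (-(3 * ((N : ℝ) + 1)))) * μ Bz) * ν' Bz := by
      calc ν' Bz * ∫⁻ z in Bz, ENNReal.ofReal (ppG z) ∂μ
          ≤ ENNReal.ofReal Λs * ENNReal.ofReal Λs * μ Bz * ∫⁻ z in Bz, ENNReal.ofReal (ppG z) ∂ν' := hX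
        _ ≤ ENNReal.ofReal Λs * ENNReal.ofReal Λs * μ Bz *
            (ENNReal.ofReal ((2 * Cg * lam + δ' * tN N) * (Λs * Real.exp (-(c * ((N : ℝ) + 1)))) +
              2 * Cg * Real.exp (-(3 * ((N : ℝ) + 1)))) * ν' Bz) := mul_le_mul_right hQ _
        _ = _ := by ring
    refine (cancel_mass hν'B0 hν'top h1).trans ?_
    rw [← ENNReal.ofReal_mul (by linarith), ← ENNReal.ofReal_mul (by positivity)]
    refine mul_le_mul_left (ENNReal.ofReal_le_ofReal ?_) _
    have hec : 0 ≤ Real.exp (-(c * ((N : ℝ) + 1))) := (Real.exp_pos _).le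
    have he3 : 0 ≤ Real.exp (-(3 * ((N : ℝ) + 1))) := (Real.exp_pos _).le
    have hΛs0 : 0 ≤ Λs := by linarith
    have hA : 0 ≤ 2 * Cg * lam := mul_nonneg (by positivity) hlam
    -- Λs Λs ((2Cg lam + δ' tN) Λs e^{-c} + 2Cg e^{-3}) ≤ Λs³ (2Cg lam + δ' + 2Cg)(e^{-c} + e^{-3})
    have h2 : (2 * Cg * lam + δ' * tN N) * (Λs * Real.exp (-(c * ((N : ℝ) + 1)))) +
        2 * Cg * Real.exp (-(3 * ((N : ℝ) + 1))) ≤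
        Λs * ((2 * Cg * lam + δ' + 2 * Cg) * (Real.exp (-(c * ((N : ℝ) + 1))) + Real.exp (-(3 * ((N : ℝ) + 1))))) := by
      have hx : (2 * Cg * lam + δ' * tN N) ≤ (2 * Cg * lam + δ' + 2 * Cg) := by
        nlinarith [mul_le_mul_of_nonneg_left htN1 hδ'.le]
      have hy : 2 * Cg ≤ Λs * (2 * Cg * lam + δ' + 2 * Cg) := by nlinarith
      nlinarith [mul_le_mul_of_nonneg_right hx (mul_nonneg hΛs0 hec), mul_le_mul_of_nonneg_right hy he3,
        mul_nonneg (mul_nonneg hΛs0 hec) hδ'.le]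
    calc Λs * Λs * ((2 * Cg * lam + δ' * tN N) * (Λs * Real.exp (-(c * ((N : ℝ) + 1)))) +
          2 * Cg * Real.exp (-(3 * ((N : ℝ) + 1))))
        ≤ Λs * Λs * (Λs * ((2 * Cg * lam + δ' + 2 * Cg) *
            (Real.exp (-(c * ((N : ℝ) + 1))) + Real.exp (-(3 * ((N : ℝ) + 1)))))) :=
          mul_le_mul_of_nonneg_left h2 (mul_nonneg hΛs0 hΛs0)
      _ = Λs ^ 3 * (2 * Cg * lam + δ' + 2 * Cg) *
            (Real.exp (-(c * ((N : ℝ) + 1))) + Real.exp (-(3 * ((N : ℝ) + 1)))) := by ring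
  calc ∫⁻ z in Bz, ENNReal.ofReal |Z z| ∂μ
      ≤ ENNReal.ofReal ((δ' + 1 / L) * tN N) * μ Bz + ENNReal.ofReal (Λs ^ 3 * (2 * Cg * lam + δ' + 2 * Cg) *
          (Real.exp (-(c * ((N : ℝ) + 1))) + Real.exp (-(3 * ((N : ℝ) + 1))))) * μ Bz :=
        hstep1.trans (add_le_add_right hXμ _)
    _ = _ := by ring

end LevelSet

/-- **Registered sub-goal `transferKept` of the glue (T-d2)**: the masses in `kept_window_bound` are finite and
non-zero — a binder-free corollary recorded for the gate (the level set of a kept bin has positive `G₁`-mass). [folklore] -/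
theorem transferKept : ∀ (σ : ℝ) (N : ℕ) (Φ : Flow σ N) (a₀ θ₀ : T3 → ℝ) (u₀ : T3 → V3) (η : ℝ) (z₀ : Phase N),
    σ ≤ 1 / 2 → ENNReal.ofReal (Real.exp (-(η * ((N : ℝ) + 1)))) ≤ localGibbsLaw σ a₀ u₀ θ₀ N Φ (keyLevel N z₀) →
    localGibbsLaw σ (fun _ => 1) (fun _ => 0) (fun _ => 1) N Φ (keyLevel N z₀) ≠ 0 := by
  intro σ N Φ a₀ θ₀ u₀ η z₀ hσ2 hkept h0
  have hμν : localGibbsLaw σ a₀ u₀ θ₀ N Φ ≪ localGibbsLaw σ (fun _ => 1) (fun _ => 0) (fun _ => 1) N Φ :=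
    localGibbsLaw_absolutelyContinuous_localGibbsLaw continuous_const continuous_const
      continuous_const (fun _ => one_pos) (fun _ => one_pos) a₀ u₀ θ₀ hσ2 N Φ
  have hμ0 : localGibbsLaw σ a₀ u₀ θ₀ N Φ (keyLevel N z₀) = 0 := hμν h0
  rw [hμ0, nonpos_iff_eq_zero, ENNReal.ofReal_eq_zero] at hkept
  exact absurd hkept (not_le.2 (Real.exp_pos _))

end Summit.AtomisticToContinuum.HydrodynamicLimit.Theorems.KickFairRelEquilibriumMesoLine

end
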